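import Summits.NavierStokesRegularity.NavierStokesRegularity.Theorems.ExtremiserTransienceKStarAttainedEulerLagrange
import HarnessLib

/-!
# Route `ExtremiserTransience`, support item `KStarAttained` (stmt-NavierStokesRegularity-24370):
# THE OBSTACLE IS ACTIVE INSIDE THE PLATEAU — the free Euler–Lagrange system fails at an interior contact point

`--supports stmt-NavierStokesRegularity-24370`. Author: prover seat `ns-et-p1` (g3).

Sharpening of `KStar.interior_contact_nonempty` (`…KStarAttainedContact`) with the explicit density `G` of
`…KStarAttainedEulerLagrange`. Let `(v, M, B)` be admissible (`‖v‖ ≤ M`), non-degenerate, and ATTAIN `κ⋆`; let `G` be the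
continuous density of the first variation on curls (`density_formula` with `c_J = J`, `c_a = −κ⋆²M²W`, `c_c = −κ⋆²M²Z`), so
that `G = 0` pointwise on the non-contact set `{‖v‖ < M}` (`eulerLagrange_offContact`).

* `KStar.exists_interior_contact_density_ne_zero` — **there is a point `x` in the INTERIOR of the contact set `{‖v‖ = M}`
  with `G x ≠ 0`.** Otherwise `G` vanishes on `{‖v‖ < M} ∪ interior{‖v‖ = M}`, whose complement is the frontier of the closed
  contact set — closed and nowhere dense — so the continuous `G` vanishes identically, hence `ℓ(curl η) = ∫⟪G, η⟫ = 0` for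
  every `η ∈ C^∞_c`; but for the divergence-free cut-off `φ_R = curl(χ·conePotential v)` the norm bound `‖v + εφ_R‖ ≤ (1+ε)M`
  gives `ℓ(φ_R) = κ⋆²M²ZW > 0`.

Read with the KKT structure (`…KStarAttainedMultiplier`): the Lagrange multiplier of the obstacle `|v| ≤ M` CHARGES THE OPEN
PLATEAU — the plateau of an extremiser is not idle (it is where the constraint does work), and the unconstrained fourth-order
Euler–Lagrange system `curl g = 0` holds off the contact set but NOT throughout its interior. (This contains
`interior_contact_nonempty`.) The item is not decided; nothing about Navier–Stokes solutions; NS regularity is NOT proved by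
anything here. [folklore]
-/

noncomputable section

open Set Filter Topology MeasureTheory Metric
open scoped InnerProductSpace RealInnerProductSpace ENNReal NNReal ContDiff Laplacian
open Literature.Analysis.FluidPDE

namespace Summit.NavierStokesRegularity.NavierStokesRegularity.Theorems

-- the problem directory repeats the summit name (`NavierStokesRegularity/NavierStokesRegularity`)
set_option linter.dupNamespace false

namespace DepletionLadder.KStar

variable {v : EuclideanSpace ℝ (Fin 3) → EuclideanSpace ℝ (Fin 3)}

/-- The union of an open set's exterior-complement pieces: for a closed set `K`, `Kᶜ ∪ interior K` is dense (its complement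
is the nowhere dense frontier of `K`). [folklore] -/
theorem dense_compl_union_interior {K : Set (EuclideanSpace ℝ (Fin 3))} (hK : IsClosed K) : Dense (Kᶜ ∪ interior K) := by
  have h : (Kᶜ ∪ interior K)ᶜ = frontier K := by
    ext x
    rw [hK.frontier_eq]
    simp only [mem_compl_iff, mem_union, Set.mem_sdiff, not_or, not_not]
  have h' : Kᶜ ∪ interior K = (frontier K)ᶜ := by rw [← h, compl_compl]
  rw [h']
  exact interior_eq_empty_iff_dense_compl.1 (interior_frontier hK)

/-- **THE MULTIPLIER CHARGES THE OPEN PLATEAU.** Let `(v, M, B)` be admissible with `‖v‖ ≤ M`, non-degenerate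
(`M‖ω‖₂‖∇ω‖₂ > 0`) and attain `κ⋆`. Then the explicit Euler–Lagrange density `G` (which vanishes on `{‖v‖ < M}` by
`eulerLagrange_offContact`) is NONZERO at some interior point of the contact set `{‖v‖ = M}`; in particular that interior is
nonempty. [folklore] -/
theorem exists_interior_contact_density_ne_zero (hv : ContDiff ℝ ∞ v) (hdiv : VectorCalculus.IsDivFree v) {M B : ℝ}
    (hM : ∀ x, ‖v x‖ ≤ M) (hB : ∀ x, ‖fderiv ℝ v x‖ ≤ B) (h0 : ∫⁻ x, ‖iteratedFDeriv ℝ 0 v x‖ₑ ^ 2 < ⊤)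
    (h1 : ∫⁻ x, ‖iteratedFDeriv ℝ 1 v x‖ₑ ^ 2 < ⊤) (h2 : ∫⁻ x, ‖iteratedFDeriv ℝ 2 v x‖ₑ ^ 2 < ⊤)
    (hpos : 0 < M * Real.sqrt (∫ x, ‖curl v x‖ ^ 2) * Real.sqrt (∫ x, frobeniusNormSq (fderiv ℝ (curl v) x)))
    (hatt : |∫ x, ⟪curl v x, fderiv ℝ v x (curl v x)⟫| =
      sInf {κ : ℝ | (∀ (v : EuclideanSpace ℝ (Fin 3) → EuclideanSpace ℝ (Fin 3)) (M B : ℝ), ContDiff ℝ (⊤ : ℕ∞) v → Literature.Analysis.FluidPDE.VectorCalculus.IsDivFree v → (∀ x, ‖v x‖ ≤ M) → (∀ x, ‖fderiv ℝ v x‖ ≤ B) → (∫⁻ x, ‖iteratedFDeriv ℝ 0 v x‖ₑ ^ 2 < ⊤) → (∫⁻ x, ‖iteratedFDeriv ℝ 1 v x‖ₑ ^ 2 < ⊤) → (∫⁻ x, ‖iteratedFDeriv ℝ 2 v x‖ₑ ^ 2 < ⊤) → |∫ x, ⟪Literature.Analysis.FluidPDE.curl v x, fderiv ℝ v x (Literature.Analysis.FluidPDE.curl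 v x)⟫_ℝ| ≤ κ * M * Real.sqrt (∫ x, ‖Literature.Analysis.FluidPDE.curl v x‖ ^ 2) * Real.sqrt (∫ x, Literature.Analysis.FluidPDE.frobeniusNormSq (fderiv ℝ (Literature.Analysis.FluidPDE.curl v) x)))} * M * Real.sqrt (∫ x, ‖curl v x‖ ^ 2) *
        Real.sqrt (∫ x, frobeniusNormSq (fderiv ℝ (curl v) x))) :
    ∃ x ∈ interior {x | ‖v x‖ = M},
      ((∫ x, ⟪curl v x, fderiv ℝ v x (curl v x)⟫) • (curl (curl (fun y => fderiv ℝ v y (curl v y))) x - curl (fun y => fderiv ℝ (curl v) y (curl v y)) x +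
        curl (curl (fun y => ∑ j, ⟪curl v y, fderiv ℝ v y (EuclideanSpace.basisFun (Fin 3) ℝ j)⟫ •
        EuclideanSpace.basisFun (Fin 3) ℝ j)) x) +
      (-(sInf {κ : ℝ | (∀ (v : EuclideanSpace ℝ (Fin 3) → EuclideanSpace ℝ (Fin 3)) (M B : ℝ), ContDiff ℝ (⊤ : ℕ∞) v → Literature.Analysis.FluidPDE.VectorCalculus.IsDivFree v → (∀ x, ‖v x‖ ≤ M) → (∀ x, ‖fderiv ℝ v x‖ ≤ B) → (∫⁻ x, ‖iteratedFDeriv ℝ 0 v x‖ₑ ^ 2 < ⊤) → (∫⁻ x, ‖iteratedFDeriv ℝ 1 v x‖ₑ ^ 2 < ⊤) → (∫⁻ x, ‖iteratedFDeriv ℝ 2 v x‖ₑ ^ 2 < ⊤) → |∫ x, ⟪Literature.Analysis.FluidPDE.curl v x, fderiv ℝ v x (Literature.Analysis.FluidPDE.curl v x)⟫_ℝ| ≤ κ * M * Real.sqrt (∫ x, ‖Literature.Analysis.FluidPDE.curl v x‖ ^ 2) * Real.sqrt (∫ x, Literature.Analysis.FluidPDE.frobeniusNormSq (fderiv ℝ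 (Literature.Analysis.FluidPDE.curl v) x)))} ^ 2 * M ^ 2 * (∫ x, frobeniusNormSq (fderiv ℝ (curl v) x)))) • curl (curl (curl v)) x - (-(sInf {κ : ℝ | (∀ (v : EuclideanSpace ℝ (Fin 3) → EuclideanSpace ℝ (Fin 3)) (M B : ℝ), ContDiff ℝ (⊤ : ℕ∞) v → Literature.Analysis.FluidPDE.VectorCalculus.IsDivFree v → (∀ x, ‖v x‖ ≤ M) → (∀ x, ‖fderiv ℝ v x‖ ≤ B) → (∫⁻ x, ‖iteratedFDeriv ℝ 0 v x‖ₑ ^ 2 < ⊤) → (∫⁻ x, ‖iteratedFDeriv ℝ 1 v x‖ₑ ^ 2 < ⊤) → (∫⁻ x, ‖iteratedFDeriv ℝ 2 v x‖ₑ ^ 2 < ⊤) → |∫ x, ⟪Literature.Analysis.FluidPDE.curl v x, fderiv ℝ v x (Literature.Analysis.FluidPDE.curl v x)⟫_ℝ| ≤ κ * M * Real.sqrt (∫ x, ‖Literature.Analysis.FluidPDE.curl v x‖ ^ 2) * Real.sqrt (∫ x, Literature.Analysis.FluidPDE.frobeniusNormSq (fderiv ℝ (Literature.Analysis.FluidPDE.curl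 v) x)))} ^ 2 * M ^ 2 * (∫ x, ‖curl v x‖ ^ 2))) • curl (curl (Δ (curl v))) x) ≠ 0 := by
  -- the constants
  have hK : 0 < sInf {κ : ℝ | (∀ (v : EuclideanSpace ℝ (Fin 3) → EuclideanSpace ℝ (Fin 3)) (M B : ℝ), ContDiff ℝ (⊤ : ℕ∞) v → Literature.Analysis.FluidPDE.VectorCalculus.IsDivFree v → (∀ x, ‖v x‖ ≤ M) → (∀ x, ‖fderiv ℝ v x‖ ≤ B) → (∫⁻ x, ‖iteratedFDeriv ℝ 0 v x‖ₑ ^ 2 < ⊤) → (∫⁻ x, ‖iteratedFDeriv ℝ 1 v x‖ₑ ^ 2 < ⊤) → (∫⁻ x, ‖iteratedFDeriv ℝ 2 v x‖ₑ ^ 2 < ⊤) → |∫ x, ⟪Literature.Analysis.FluidPDE.curl v x, fderiv ℝ v x (Literature.Analysis.FluidPDE.curl v x)⟫_ℝ| ≤ κ * M * Real.sqrt (∫ x, ‖Literature.Analysis.FluidPDE.curl v x‖ ^ 2) * Real.sqrt (∫ x, Literature.Analysis.FluidPDE.frobeniusNormSq (fderiv ℝ (Literature.Analysis.FluidPDE.curl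 v) x)))} := lt_trans (by norm_num) sharpDepletion_gt
  have hM0 : 0 ≤ M := (norm_nonneg _).trans (hM 0)
  have hZ0 : 0 ≤ (∫ x, ‖curl v x‖ ^ 2) := integral_nonneg fun x => sq_nonneg _
  have hW0 : 0 ≤ (∫ x, frobeniusNormSq (fderiv ℝ (curl v) x)) := integral_nonneg fun x => frobeniusNormSq_nonneg _
  have hMpos : 0 < M := by
    rcases hM0.eq_or_lt with h | h
    · rw [← h, zero_mul, zero_mul] at hpos; exact absurd hpos (lt_irrefl _)
    · exact h
  have hZpos : 0 < (∫ x, ‖curl v x‖ ^ 2) := by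
    rcases hZ0.eq_or_lt with h | h
    · rw [← h, Real.sqrt_zero, mul_zero, zero_mul] at hpos; exact absurd hpos (lt_irrefl _)
    · exact h
  have hWpos : 0 < (∫ x, frobeniusNormSq (fderiv ℝ (curl v) x)) := by
    rcases hW0.eq_or_lt with h | h
    · rw [← h, Real.sqrt_zero, mul_zero] at hpos; exact absurd hpos (lt_irrefl _)
    · exact h
  by_contra hne
  simp only [not_exists, not_and, ne_eq, not_not] at hne
  -- `G` vanishes on `{‖v‖ < M} ∪ interior {‖v‖ = M}`, a dense set, hence everywhere
  have hGc := continuous_density hv (∫ x, ⟪curl v x, fderiv ℝ v x (curl v x)⟫) (-(sInf {κ : ℝ | (∀ (v : EuclideanSpace ℝ (Fin 3) → EuclideanSpace ℝ (Fin 3)) (M B : ℝ), ContDiff ℝ (⊤ : ℕ∞) v → Literature.Analysis.FluidPDE.VectorCalculus.IsDivFree v → (∀ x, ‖v x‖ ≤ M) → (∀ x, ‖fderiv ℝ v x‖ ≤ B) → (∫⁻ x, ‖iteratedFDeriv ℝ 0 v x‖ₑ ^ 2 < ⊤) → (∫⁻ x, ‖iteratedFDeriv ℝ 1 v x‖ₑ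 ^ 2 < ⊤) → (∫⁻ x, ‖iteratedFDeriv ℝ 2 v x‖ₑ ^ 2 < ⊤) → |∫ x, ⟪Literature.Analysis.FluidPDE.curl v x, fderiv ℝ v x (Literature.Analysis.FluidPDE.curl v x)⟫_ℝ| ≤ κ * M * Real.sqrt (∫ x, ‖Literature.Analysis.FluidPDE.curl v x‖ ^ 2) * Real.sqrt (∫ x, Literature.Analysis.FluidPDE.frobeniusNormSq (fderiv ℝ (Literature.Analysis.FluidPDE.curl v) x)))} ^ 2 * M ^ 2 * (∫ x, frobeniusNormSq (fderiv ℝ (curl v) x)))) (-(sInf {κ : ℝ | (∀ (v : EuclideanSpace ℝ (Fin 3) → EuclideanSpace ℝ (Fin 3)) (M B : ℝ), ContDiff ℝ (⊤ : ℕ∞) v → Literature.Analysis.FluidPDE.VectorCalculus.IsDivFree v → (∀ x, ‖v x‖ ≤ M) → (∀ x, ‖fderiv ℝ v x‖ ≤ B) → (∫⁻ x, ‖iteratedFDeriv ℝ 0 v x‖ₑ ^ 2 < ⊤) → (∫⁻ x, ‖iteratedFDeriv ℝ 1 v x‖ₑ ^ 2 < ⊤) → (∫⁻ x, ‖iteratedFDeriv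 ℝ 2 v x‖ₑ ^ 2 < ⊤) → |∫ x, ⟪Literature.Analysis.FluidPDE.curl v x, fderiv ℝ v x (Literature.Analysis.FluidPDE.curl v x)⟫_ℝ| ≤ κ * M * Real.sqrt (∫ x, ‖Literature.Analysis.FluidPDE.curl v x‖ ^ 2) * Real.sqrt (∫ x, Literature.Analysis.FluidPDE.frobeniusNormSq (fderiv ℝ (Literature.Analysis.FluidPDE.curl v) x)))} ^ 2 * M ^ 2 * (∫ x, ‖curl v x‖ ^ 2)))
  have hKc : IsClosed {x | ‖v x‖ = M} := isClosed_eq (continuous_norm.comp hv.continuous) continuous_const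
  have hUeq : ({x | ‖v x‖ = M} : Set (EuclideanSpace ℝ (Fin 3)))ᶜ = {x | ‖v x‖ < M} := by
    ext x
    simp only [mem_compl_iff, mem_setOf_eq]
    exact ⟨fun h => lt_of_le_of_ne (hM x) h, fun h => ne_of_lt h⟩
  have hdense : Dense ({x | ‖v x‖ < M} ∪ interior {x | ‖v x‖ = M}) := by
    rw [← hUeq]
    exact dense_compl_union_interior hKc
  have hGD : EqOn (fun x => ((∫ x, ⟪curl v x, fderiv ℝ v x (curl v x)⟫) • (curl (curl (fun y => fderiv ℝ v y (curl v y))) x - curl (fun y => fderiv ℝ (curl v) y (curl v y)) x +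
        curl (curl (fun y => ∑ j, ⟪curl v y, fderiv ℝ v y (EuclideanSpace.basisFun (Fin 3) ℝ j)⟫ •
        EuclideanSpace.basisFun (Fin 3) ℝ j)) x) +
      (-(sInf {κ : ℝ | (∀ (v : EuclideanSpace ℝ (Fin 3) → EuclideanSpace ℝ (Fin 3)) (M B : ℝ), ContDiff ℝ (⊤ : ℕ∞) v → Literature.Analysis.FluidPDE.VectorCalculus.IsDivFree v → (∀ x, ‖v x‖ ≤ M) → (∀ x, ‖fderiv ℝ v x‖ ≤ B) → (∫⁻ x, ‖iteratedFDeriv ℝ 0 v x‖ₑ ^ 2 < ⊤) → (∫⁻ x, ‖iteratedFDeriv ℝ 1 v x‖ₑ ^ 2 < ⊤) → (∫⁻ x, ‖iteratedFDeriv ℝ 2 v x‖ₑ ^ 2 < ⊤) → |∫ x, ⟪Literature.Analysis.FluidPDE.curl v x, fderiv ℝ v x (Literature.Analysis.FluidPDE.curl v x)⟫_ℝ| ≤ κ * M * Real.sqrt (∫ x, ‖Literature.Analysis.FluidPDE.curl v x‖ ^ 2) * Real.sqrt (∫ x, Literature.Analysis.FluidPDE.frobeniusNormSq (fderiv ℝ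 (Literature.Analysis.FluidPDE.curl v) x)))} ^ 2 * M ^ 2 * (∫ x, frobeniusNormSq (fderiv ℝ (curl v) x)))) • curl (curl (curl v)) x - (-(sInf {κ : ℝ | (∀ (v : EuclideanSpace ℝ (Fin 3) → EuclideanSpace ℝ (Fin 3)) (M B : ℝ), ContDiff ℝ (⊤ : ℕ∞) v → Literature.Analysis.FluidPDE.VectorCalculus.IsDivFree v → (∀ x, ‖v x‖ ≤ M) → (∀ x, ‖fderiv ℝ v x‖ ≤ B) → (∫⁻ x, ‖iteratedFDeriv ℝ 0 v x‖ₑ ^ 2 < ⊤) → (∫⁻ x, ‖iteratedFDeriv ℝ 1 v x‖ₑ ^ 2 < ⊤) → (∫⁻ x, ‖iteratedFDeriv ℝ 2 v x‖ₑ ^ 2 < ⊤) → |∫ x, ⟪Literature.Analysis.FluidPDE.curl v x, fderiv ℝ v x (Literature.Analysis.FluidPDE.curl v x)⟫_ℝ| ≤ κ * M * Real.sqrt (∫ x, ‖Literature.Analysis.FluidPDE.curl v x‖ ^ 2) * Real.sqrt (∫ x, Literature.Analysis.FluidPDE.frobeniusNormSq (fderiv ℝ (Literature.Analysis.FluidPDE.curl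 v) x)))} ^ 2 * M ^ 2 * (∫ x, ‖curl v x‖ ^ 2))) • curl (curl (Δ (curl v))) x)) 0 ({x | ‖v x‖ < M} ∪ interior {x | ‖v x‖ = M}) := by
    rintro x (hx | hx)
    · exact eulerLagrange_offContact hv hdiv hM hB h0 h1 h2 hatt hx
    · exact hne x hx
  have hG0 : (fun x => ((∫ x, ⟪curl v x, fderiv ℝ v x (curl v x)⟫) • (curl (curl (fun y => fderiv ℝ v y (curl v y))) x - curl (fun y => fderiv ℝ (curl v) y (curl v y)) x +
        curl (curl (fun y => ∑ j, ⟪curl v y, fderiv ℝ v y (EuclideanSpace.basisFun (Fin 3) ℝ j)⟫ •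
        EuclideanSpace.basisFun (Fin 3) ℝ j)) x) +
      (-(sInf {κ : ℝ | (∀ (v : EuclideanSpace ℝ (Fin 3) → EuclideanSpace ℝ (Fin 3)) (M B : ℝ), ContDiff ℝ (⊤ : ℕ∞) v → Literature.Analysis.FluidPDE.VectorCalculus.IsDivFree v → (∀ x, ‖v x‖ ≤ M) → (∀ x, ‖fderiv ℝ v x‖ ≤ B) → (∫⁻ x, ‖iteratedFDeriv ℝ 0 v x‖ₑ ^ 2 < ⊤) → (∫⁻ x, ‖iteratedFDeriv ℝ 1 v x‖ₑ ^ 2 < ⊤) → (∫⁻ x, ‖iteratedFDeriv ℝ 2 v x‖ₑ ^ 2 < ⊤) → |∫ x, ⟪Literature.Analysis.FluidPDE.curl v x, fderiv ℝ v x (Literature.Analysis.FluidPDE.curl v x)⟫_ℝ| ≤ κ * M * Real.sqrt (∫ x, ‖Literature.Analysis.FluidPDE.curl v x‖ ^ 2) * Real.sqrt (∫ x, Literature.Analysis.FluidPDE.frobeniusNormSq (fderiv ℝ (Literature.Analysis.FluidPDE.curl v) x)))} ^ 2 * M ^ 2 * (∫ x, frobeniusNormSq (fderiv ℝ (curl v)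 x)))) • curl (curl (curl v)) x - (-(sInf {κ : ℝ | (∀ (v : EuclideanSpace ℝ (Fin 3) → EuclideanSpace ℝ (Fin 3)) (M B : ℝ), ContDiff ℝ (⊤ : ℕ∞) v → Literature.Analysis.FluidPDE.VectorCalculus.IsDivFree v → (∀ x, ‖v x‖ ≤ M) → (∀ x, ‖fderiv ℝ v x‖ ≤ B) → (∫⁻ x, ‖iteratedFDeriv ℝ 0 v x‖ₑ ^ 2 < ⊤) → (∫⁻ x, ‖iteratedFDeriv ℝ 1 v x‖ₑ ^ 2 < ⊤) → (∫⁻ x, ‖iteratedFDeriv ℝ 2 v x‖ₑ ^ 2 < ⊤) → |∫ x, ⟪Literature.Analysis.FluidPDE.curl v x, fderiv ℝ v x (Literature.Analysis.FluidPDE.curl v x)⟫_ℝ| ≤ κ * M * Real.sqrt (∫ x, ‖Literature.Analysis.FluidPDE.curl v x‖ ^ 2) * Real.sqrt (∫ x, Literature.Analysis.FluidPDE.frobeniusNormSq (fderiv ℝ (Literature.Analysis.FluidPDE.curl v) x)))} ^ 2 * M ^ 2 * (∫ x, ‖curl v x‖ ^ 2))) • curl (curl (Δ (curl v))) x)) =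 0 := Continuous.ext_on hdense hGc continuous_const hGD
  -- the cut-off perturbation `φ_R = curl (χ · conePotential v)`
  obtain ⟨R, hR0, hR⟩ := exists_radius_norm_lt hv hB h0 (half_pos hMpos)
  let χ : ContDiffBump (0 : EuclideanSpace ℝ (Fin 3)) := ⟨R + 1, R + 2, by linarith, by linarith⟩
  obtain ⟨hφ, hφc, hφdiv, -⟩ := cutoff_field hv hdiv χ
  obtain ⟨ε₀, hε₀, hbound⟩ := exists_normBound_cutoff hv hdiv hM hMpos hR χ (by
    show R < R + 1
    linarith)
  have hm1 := firstVariation_eq_of_normBound hv hdiv hB h0 h1 h2 hatt hφ hφc hφdiv hε₀ hbound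
  have hη : ContDiff ℝ ∞ fun y => χ y • conePotential v y := χ.contDiff.smul (contDiff_conePotential hv)
  have hηc : HasCompactSupport fun y => χ y • conePotential v y := χ.hasCompactSupport.smul_right
  have hd := density_formula hv (∫ x, ⟪curl v x, fderiv ℝ v x (curl v x)⟫) (-(sInf {κ : ℝ | (∀ (v : EuclideanSpace ℝ (Fin 3) → EuclideanSpace ℝ (Fin 3)) (M B : ℝ), ContDiff ℝ (⊤ : ℕ∞) v → Literature.Analysis.FluidPDE.VectorCalculus.IsDivFree v → (∀ x, ‖v x‖ ≤ M) → (∀ x, ‖fderiv ℝ v x‖ ≤ B) → (∫⁻ x, ‖iteratedFDeriv ℝ 0 v x‖ₑ ^ 2 < ⊤) → (∫⁻ x, ‖iteratedFDeriv ℝ 1 v x‖ₑ ^ 2 < ⊤) → (∫⁻ x, ‖iteratedFDeriv ℝ 2 v x‖ₑ ^ 2 < ⊤) → |∫ x, ⟪Literature.Analysis.FluidPDE.curl v x, fderiv ℝ v x (Literature.Analysis.FluidPDE.curl v x)⟫_ℝ| ≤ κ * M * Real.sqrt (∫ x, ‖Literature.Analysis.FluidPDE.curl v x‖ ^ 2)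 * Real.sqrt (∫ x, Literature.Analysis.FluidPDE.frobeniusNormSq (fderiv ℝ (Literature.Analysis.FluidPDE.curl v) x)))} ^ 2 * M ^ 2 * (∫ x, frobeniusNormSq (fderiv ℝ (curl v) x)))) (-(sInf {κ : ℝ | (∀ (v : EuclideanSpace ℝ (Fin 3) → EuclideanSpace ℝ (Fin 3)) (M B : ℝ), ContDiff ℝ (⊤ : ℕ∞) v → Literature.Analysis.FluidPDE.VectorCalculus.IsDivFree v → (∀ x, ‖v x‖ ≤ M) → (∀ x, ‖fderiv ℝ v x‖ ≤ B) → (∫⁻ x, ‖iteratedFDeriv ℝ 0 v x‖ₑ ^ 2 < ⊤) → (∫⁻ x, ‖iteratedFDeriv ℝ 1 v x‖ₑ ^ 2 < ⊤) → (∫⁻ x, ‖iteratedFDeriv ℝ 2 v x‖ₑ ^ 2 < ⊤) → |∫ x, ⟪Literature.Analysis.FluidPDE.curl v x, fderiv ℝ v x (Literature.Analysis.FluidPDE.curl v x)⟫_ℝ| ≤ κ * M * Real.sqrt (∫ x, ‖Literature.Analysis.FluidPDE.curl v x‖ ^ 2) * Real.sqrt (∫ x, Literature.Analysis.FluidPDE.frobeniusNormSq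 (fderiv ℝ (Literature.Analysis.FluidPDE.curl v) x)))} ^ 2 * M ^ 2 * (∫ x, ‖curl v x‖ ^ 2))) hη hηc
  have hzero : ∫ y, ⟪((∫ x, ⟪curl v x, fderiv ℝ v x (curl v x)⟫) • (curl (curl (fun y => fderiv ℝ v y (curl v y))) y - curl (fun y => fderiv ℝ (curl v) y (curl v y)) y +
        curl (curl (fun y => ∑ j, ⟪curl v y, fderiv ℝ v y (EuclideanSpace.basisFun (Fin 3) ℝ j)⟫ •
        EuclideanSpace.basisFun (Fin 3) ℝ j)) y) +
      (-(sInf {κ : ℝ | (∀ (v : EuclideanSpace ℝ (Fin 3) → EuclideanSpace ℝ (Fin 3)) (M B : ℝ), ContDiff ℝ (⊤ : ℕ∞) v → Literature.Analysis.FluidPDE.VectorCalculus.IsDivFree v → (∀ x, ‖v x‖ ≤ M) → (∀ x, ‖fderiv ℝ v x‖ ≤ B) → (∫⁻ x, ‖iteratedFDeriv ℝ 0 v x‖ₑ ^ 2 < ⊤) → (∫⁻ x, ‖iteratedFDeriv ℝ 1 v x‖ₑ ^ 2 < ⊤) → (∫⁻ x, ‖iteratedFDeriv ℝ 2 v x‖ₑ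 ^ 2 < ⊤) → |∫ x, ⟪Literature.Analysis.FluidPDE.curl v x, fderiv ℝ v x (Literature.Analysis.FluidPDE.curl v x)⟫_ℝ| ≤ κ * M * Real.sqrt (∫ x, ‖Literature.Analysis.FluidPDE.curl v x‖ ^ 2) * Real.sqrt (∫ x, Literature.Analysis.FluidPDE.frobeniusNormSq (fderiv ℝ (Literature.Analysis.FluidPDE.curl v) x)))} ^ 2 * M ^ 2 * (∫ x, frobeniusNormSq (fderiv ℝ (curl v) x)))) • curl (curl (curl v)) y - (-(sInf {κ : ℝ | (∀ (v : EuclideanSpace ℝ (Fin 3) → EuclideanSpace ℝ (Fin 3)) (M B : ℝ), ContDiff ℝ (⊤ : ℕ∞) v → Literature.Analysis.FluidPDE.VectorCalculus.IsDivFree v → (∀ x, ‖v x‖ ≤ M) → (∀ x, ‖fderiv ℝ v x‖ ≤ B) → (∫⁻ x, ‖iteratedFDeriv ℝ 0 v x‖ₑ ^ 2 < ⊤) → (∫⁻ x, ‖iteratedFDeriv ℝ 1 v x‖ₑ ^ 2 < ⊤) → (∫⁻ x, ‖iteratedFDeriv ℝ 2 v x‖ₑ ^ 2 < ⊤) → |∫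 x, ⟪Literature.Analysis.FluidPDE.curl v x, fderiv ℝ v x (Literature.Analysis.FluidPDE.curl v x)⟫_ℝ| ≤ κ * M * Real.sqrt (∫ x, ‖Literature.Analysis.FluidPDE.curl v x‖ ^ 2) * Real.sqrt (∫ x, Literature.Analysis.FluidPDE.frobeniusNormSq (fderiv ℝ (Literature.Analysis.FluidPDE.curl v) x)))} ^ 2 * M ^ 2 * (∫ x, ‖curl v x‖ ^ 2))) • curl (curl (Δ (curl v))) y), (fun y => χ y • conePotential v y) y⟫ = 0 := by
    have := congrFun hG0
    simp only [Pi.zero_apply] at this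
    simp only [this, inner_zero_left, integral_zero]
  rw [hzero] at hd
  rw [hm1] at hd
  have : sInf {κ : ℝ | (∀ (v : EuclideanSpace ℝ (Fin 3) → EuclideanSpace ℝ (Fin 3)) (M B : ℝ), ContDiff ℝ (⊤ : ℕ∞) v → Literature.Analysis.FluidPDE.VectorCalculus.IsDivFree v → (∀ x, ‖v x‖ ≤ M) → (∀ x, ‖fderiv ℝ v x‖ ≤ B) → (∫⁻ x, ‖iteratedFDeriv ℝ 0 v x‖ₑ ^ 2 < ⊤) → (∫⁻ x, ‖iteratedFDeriv ℝ 1 v x‖ₑ ^ 2 < ⊤) → (∫⁻ x, ‖iteratedFDeriv ℝ 2 v x‖ₑ ^ 2 < ⊤) → |∫ x, ⟪Literature.Analysis.FluidPDE.curl v x, fderiv ℝ v x (Literature.Analysis.FluidPDE.curl v x)⟫_ℝ| ≤ κ * M * Real.sqrt (∫ x, ‖Literature.Analysis.FluidPDE.curl v x‖ ^ 2) * Real.sqrt (∫ x, Literature.Analysis.FluidPDE.frobeniusNormSq (fderiv ℝ (Literature.Analysis.FluidPDE.curl v) x)))} ^ 2 * M ^ 2 * ((∫ x, ‖curl v x‖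 ^ 2) * (∫ x, frobeniusNormSq (fderiv ℝ (curl v) x))) = 0 := by linear_combination hd
  have hprod : 0 < sInf {κ : ℝ | (∀ (v : EuclideanSpace ℝ (Fin 3) → EuclideanSpace ℝ (Fin 3)) (M B : ℝ), ContDiff ℝ (⊤ : ℕ∞) v → Literature.Analysis.FluidPDE.VectorCalculus.IsDivFree v → (∀ x, ‖v x‖ ≤ M) → (∀ x, ‖fderiv ℝ v x‖ ≤ B) → (∫⁻ x, ‖iteratedFDeriv ℝ 0 v x‖ₑ ^ 2 < ⊤) → (∫⁻ x, ‖iteratedFDeriv ℝ 1 v x‖ₑ ^ 2 < ⊤) → (∫⁻ x, ‖iteratedFDeriv ℝ 2 v x‖ₑ ^ 2 < ⊤) → |∫ x, ⟪Literature.Analysis.FluidPDE.curl v x, fderiv ℝ v x (Literature.Analysis.FluidPDE.curl v x)⟫_ℝ| ≤ κ * M * Real.sqrt (∫ x, ‖Literature.Analysis.FluidPDE.curl v x‖ ^ 2) * Real.sqrt (∫ x, Literature.Analysis.FluidPDE.frobeniusNormSq (fderiv ℝ (Literature.Analysis.FluidPDE.curl v) x)))} ^ 2 * M ^ 2 * ((∫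 x, ‖curl v x‖ ^ 2) * (∫ x, frobeniusNormSq (fderiv ℝ (curl v) x))) := by positivity
  exact absurd this hprod.ne'

end DepletionLadder.KStar

end Summit.NavierStokesRegularity.NavierStokesRegularity.Theorems

end
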